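import Mathlib
import Summits.QuantumFields.YangMills.Theorems.BalabanUVNodesN15BackgroundEntry2ByParts
import HarnessLib

/-!
# Route «BalabanUVNodes» (K4 «SpineRates»), node N15 = NE2, BACKGROUND LAYER — THE DRESSED ENTRY 2 FROM ITS NATURAL LETTERS: the source `B̂ = (1 + E₀R̃)∘Σ_νS_νpr_ν`,
# the rows `K_μ = (Sh_μC^a_μ + C^b_μ)∘Σ_νS_νpr_ν`, their block majorants and η-defects by Leibniz, and the η-DEFECT OF `E₂ = B̂∘(1+K̂)⁻¹` — NO MIXED PIECE `∇_μG∇_ν*`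

Cell `pub-ymgap`, seat `pub-ymgap-dag-n15-c` (generation g8; R134 ACCELERATION SEAT, strategy s1; HUMAN RULING D-0062; chair R424 venue; `bears_on: R4∕N15`).  Filed
`--kind proof --supports stmt-QuantumFields-20509 --as helper` (K3⁶; count-neutral).  Imports BY NAME this seat's `…N15BackgroundEntry2ByParts` (`e2ByParts`, `E2Unit`,
`e2Unit_of_small`, `hasMaj_e2ByParts`, `hasMaj_idef_e2ByParts`; through it `…N15BackgroundTupleCalculus`: `sumJ`, `hasMaj_sumJ_exp`, `idef_sumJ`, and S1∕S2's helpers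
`hasMaj_exp_comp_diagK`, `hasMaj_diagK_comp_exp`, `hasMaj_add_exp`, `hasMaj_exp_mono`); nothing in the tree is modified.

WHY.  `…N15BackgroundEntry2ByParts.hasMaj_idef_e2ByParts` bounds the η-defect of the by-parts entry-2 object `E₂ = B̂∘(1+K̂)⁻¹` from FIVE composite letters (`B̂′`,
`𝔇(B̂′,B̂)`, `K_μ`, `K′_μ`, `𝔇(K′_μ,K_μ)`).  THIS FILE reduces those to the NATURAL letters of the closed system (`…TupleCalculus.sumJ_e2_comp_addId`): the `U ≡ 1` entry-2
operators `S_ν = G∇_ν*` of the two spacings and their η-defect (dag-n15-a's entry 2 on the torus family), the dressed entry 0 `E₀` and its η-defect (the lineage's pair-space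
letters), the by-parts multiplier `R̃` (block-diagonal coefficient letters of (3.35)), the one-step shifts `Sh_μ` (block cost `c_T`), the translated coefficient operators
`C^a_μ, C^b_μ` (diagonal letters) — and ONE genuinely two-grid letter, the SHIFT DEFECT on the range of `C^a_μ∘Σ`: `𝔇(Sh′_μ, Sh_μ)∘(C^a_μ∘Σ_νS_νpr_ν) ≤ m_T e^{−δd}` (on the torus:
the fine one-step shift against the coarse one through King's pairing = the one-step difference of a Hölder-regular function inside the block, `0` on its face — this seat's W1
device `hasMaj_idefShift_comp` on [B4-I] (1.111)'s tensor clause, dag-n15-a part 66 `hasMaj_divSteps_pair`).  Every term of the resulting bound carries exactly one of the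
rate-small letters `m_S, m₀, o, m_T`.

CONTENTS ([folklore] bookkeeping; 6 small defs = 2 operators + 4 named constants).
* §1 (one lattice) `hasMaj_exp_of_diagK`; `bopOf`, `krowOf`; `hasMaj_sdiv` (`|J|β_S`), ★ `hasMaj_bopOf` (`|J|β_S + β₀r|J|β_Sc_r` at `δ − σ`), ★ `hasMaj_krowOf` (`(c_Ta₀ + a₀)|J|β_Sc_r`).
* §2 (two lattices) `idef_bopOf`, `idef_krowOf` (Leibniz), `hasMaj_idef_sdiv`, `mBOf`, `mKOf`, ★ `hasMaj_idef_bopOf`, ★ `hasMaj_idef_krowOf`.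
* §3 `rowConst`, `srcConst`, `e2Unit_of_letters` (`q = Rc_r² < 1`), ★ `hasMaj_entry2_of_letters` (`ρ + 4σ ≤ δ`), ★★ **`hasMaj_idef_entry2_of_letters`** (`ρ + 5σ ≤ δ`).

HONEST FRAMING ∕ LIMITS.  Bookkeeping over hypothesis-shaped letters on an abstract [B6] carrier ((2.54), `d ≥ 0`, `d(y,y) = 0`, (2.61) at `σ`); constants crude and ours;
nothing about Bałaban's `G(U)` asserted; the torus instantiation at `gOp` (shift cost `e^{δ}`, the shift-defect letter from part 66, `𝔇(S′_ν,S_ν)` from dag-n15-a's entry 2)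
is the next file.  NE2⁺ NOT PRINTED, NOT proved, not claimed; count-neutral (typed 28∕28 · discharged 5∕27 of record unchanged); N15 NOT discharged; one finite lattice at fixed
ε — NOT ℝ⁴, NOT infinite volume, NOT OS, NOT a mass gap, NOT Clay.
-/

noncomputable section

open scoped BigOperators
open Finset

namespace Summit.QuantumFields.YangMills.BalabanUVNodes.N15.BackgroundLayer

open Literature.MathematicalPhysics.QuantumFieldTheory.Balaban1983to89
open Literature.MathematicalPhysics.QuantumFieldTheory.Balaban1983to89.B11SectG (BlockNorm HasMaj RowSum hasMaj_comp hasMaj_comp_exp)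
open Literature.MathematicalPhysics.QuantumFieldTheory.Balaban1983to89.T4EtaRateDefect (idef idef_apply idef_comp idef_add)
open Literature.MathematicalPhysics.QuantumFieldTheory.Balaban1983to89.T4EtaRateCoeffDefect (pull pull_apply diagK diagK_nonneg)
open Literature.MathematicalPhysics.QuantumFieldTheory.Balaban1983to89.B6RandomWalk (Triangle254)
open Summit.QuantumFields.YangMills.BalabanUVNodes.N15.MatrixSpecies (liftMap liftBlk)
open Summit.QuantumFields.YangMills.BalabanUVNodes.N15.BackgroundModel (kappa_ofBlocks)
open Summit.QuantumFields.YangMills.BalabanUVNodes.N15.SiteLayer (hasMaj_exp_comp_diagK hasMaj_diagK_comp_exp hasMaj_add_exp hasMaj_exp_mono)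

/-! ## §1 The source operator `B̂ = (1 + E₀R̃)∘Σ_νS_νpr_ν` and the rows `K_μ = (S_μC^a′_μ + C^b″_μ)∘Σ_νS_νpr_ν` from their letters (one lattice) -/

section OneLattice

variable {X J : Type} [Fintype X] [Fintype J] [DecidableEq X] [DecidableEq J] {g : B6.Geometry} (blk : X → g.Site) {σ cr : ℝ}
variable {Sd : J → ((X → ℝ) →ₗ[ℝ] (X → ℝ))} {E0 Rt : (X → ℝ) →ₗ[ℝ] (X → ℝ)} {Sh Ca Cb : J → ((X → ℝ) →ₗ[ℝ] (X → ℝ))}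
  {βS β₀ r cT a₀ δ : ℝ}

omit [DecidableEq X] [Fintype J] [DecidableEq J] in
/-- a block-DIAGONAL majorant `diagK a` (`a ≥ 0`) is an exponential one `a·e^{−δd}` at every rate when `d(y,y) = 0`. [folklore] -/
theorem hasMaj_exp_of_diagK {F₁ : Type} [AddCommGroup F₁] [Module ℝ F₁] {b₁ : BlockNorm g F₁} {T : F₁ →ₗ[ℝ] (X → ℝ)} {a : ℝ}
    (hd0 : ∀ y : g.Site, g.dist y y = 0) (ha : 0 ≤ a) (δ : ℝ) (h : HasMaj b₁ (BlockNorm.ofBlocks g blk) T (diagK fun _ => a)) :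
    HasMaj b₁ (BlockNorm.ofBlocks g blk) T (fun y y' => a * Real.exp (-(δ * g.dist y y'))) := by
  refine h.mono fun y y' => ?_
  unfold diagK
  split_ifs with hy
  · subst hy
    rw [hd0, mul_zero, neg_zero, Real.exp_zero, mul_one]
  · exact mul_nonneg ha (Real.exp_nonneg _)

/-- THE SOURCE OPERATOR of the device: `B̂ = Σ_νS_νpr_ν + E₀∘R̃∘Σ_νS_νpr_ν`. [folklore] -/
def bopOf (Sd : J → ((X → ℝ) →ₗ[ℝ] (X → ℝ))) (E0 Rt : (X → ℝ) →ₗ[ℝ] (X → ℝ)) : (X × J → ℝ) →ₗ[ℝ] (X → ℝ) :=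
  sumJ Sd + E0 ∘ₗ Rt ∘ₗ sumJ Sd

/-- THE ROWS of the device: `K_μ = (Sh_μ∘C^a_μ + C^b_μ)∘Σ_νS_νpr_ν` (`Sh_μ` the one-step shift, `C^a_μ, C^b_μ` the translated coefficient operators). [folklore] -/
def krowOf (Sd : J → ((X → ℝ) →ₗ[ℝ] (X → ℝ))) (Sh Ca Cb : J → ((X → ℝ) →ₗ[ℝ] (X → ℝ))) (μ : J) : (X × J → ℝ) →ₗ[ℝ] (X → ℝ) :=
  (Sh μ ∘ₗ Ca μ + Cb μ) ∘ₗ sumJ Sd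

omit [DecidableEq X] [DecidableEq J] in
/-- `Σ_νS_νpr_ν ≤ |J|·β_S·e^{−δd}`. [folklore] -/
theorem hasMaj_sdiv (hβS : 0 ≤ βS)
    (hS : ∀ ν, HasMaj (BlockNorm.ofBlocks g blk) (BlockNorm.ofBlocks g blk) (Sd ν) (fun y y' => βS * Real.exp (-(δ * g.dist y y')))) :
    HasMaj (BlockNorm.ofBlocks g (liftBlk blk J)) (BlockNorm.ofBlocks g blk) (sumJ Sd) (fun y y' => Fintype.card J * βS * Real.exp (-(δ * g.dist y y'))) :=
  hasMaj_sumJ_exp blk hβS hS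

omit [DecidableEq X] [DecidableEq J] in
/-- **`B̂ ≤ (|J|β_S + β₀·r·|J|β_S·c_r)·e^{−(δ−σ)d}`** from `S_ν ≤ β_S e^{−δd}`, `E₀ ≤ β₀ e^{−δd}`, `R̃ ≤ diagK r`. [folklore] -/
theorem hasMaj_bopOf (htri : Triangle254 g) (hd : ∀ a b : g.Site, 0 ≤ g.dist a b) (hrow : RowSum g σ cr) (hσ : 0 ≤ σ) (hσδ : σ ≤ δ)
    (hβS : 0 ≤ βS) (hβ₀ : 0 ≤ β₀) (hr : 0 ≤ r)
    (hS : ∀ ν, HasMaj (BlockNorm.ofBlocks g blk) (BlockNorm.ofBlocks g blk) (Sd ν) (fun y y' => βS * Real.exp (-(δ * g.dist y y'))))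
    (hE : HasMaj (BlockNorm.ofBlocks g blk) (BlockNorm.ofBlocks g blk) E0 (fun y y' => β₀ * Real.exp (-(δ * g.dist y y'))))
    (hR : HasMaj (BlockNorm.ofBlocks g blk) (BlockNorm.ofBlocks g blk) Rt (diagK fun _ => r)) :
    HasMaj (BlockNorm.ofBlocks g (liftBlk blk J)) (BlockNorm.ofBlocks g blk) (bopOf Sd E0 Rt)
      (fun y y' => (Fintype.card J * βS + β₀ * r * (Fintype.card J * βS) * cr) * Real.exp (-((δ - σ) * g.dist y y'))) := by
  have hJβ : 0 ≤ Fintype.card J * βS := mul_nonneg (Nat.cast_nonneg _) hβS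
  have hSd := hasMaj_sdiv blk hβS hS
  have hER := hasMaj_exp_comp_diagK (b₁ := BlockNorm.ofBlocks g blk) (b₃ := BlockNorm.ofBlocks g blk) blk hβ₀ hE hR
  have h2 := hasMaj_comp_exp (b₁ := BlockNorm.ofBlocks g (liftBlk blk J)) (b₂ := BlockNorm.ofBlocks g blk) (b₃ := BlockNorm.ofBlocks g blk) (ρ := δ - σ)
    htri hd hrow (mul_nonneg hβ₀ hr) hJβ (by linarith) (by linarith) (by linarith) hER hSd
  have h2' : HasMaj (BlockNorm.ofBlocks g (liftBlk blk J)) (BlockNorm.ofBlocks g blk) (E0 ∘ₗ Rt ∘ₗ sumJ Sd)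
      (fun a b => (BlockNorm.ofBlocks g blk).κ * (β₀ * r) * (Fintype.card J * βS) * cr * Real.exp (-((δ - σ) * g.dist a b))) := by
    rw [← LinearMap.comp_assoc]; exact h2
  have h1 := hasMaj_exp_mono hd hJβ (show δ - σ ≤ δ by linarith) hSd
  rw [bopOf]
  exact (hasMaj_add_exp h1 h2').mono fun a b => le_of_eq (by rw [kappa_ofBlocks]; ring)

omit [DecidableEq X] [DecidableEq J] in
/-- **THE ROWS `K_μ ≤ (c_T·a₀ + a₀)·|J|β_S·c_r·e^{−(δ−σ)d}`** from `Sh_μ ≤ c_T e^{−δd}` (shift cost), `C^a_μ, C^b_μ ≤ diagK a₀`, `S_ν ≤ β_S e^{−δd}` (`d(y,y) = 0`). [folklore] -/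
theorem hasMaj_krowOf (htri : Triangle254 g) (hd : ∀ a b : g.Site, 0 ≤ g.dist a b) (hd0 : ∀ y : g.Site, g.dist y y = 0) (hrow : RowSum g σ cr) (hσ : 0 ≤ σ)
    (hσδ : σ ≤ δ) (hβS : 0 ≤ βS) (hcT : 0 ≤ cT) (ha₀ : 0 ≤ a₀)
    (hS : ∀ ν, HasMaj (BlockNorm.ofBlocks g blk) (BlockNorm.ofBlocks g blk) (Sd ν) (fun y y' => βS * Real.exp (-(δ * g.dist y y'))))
    (hSh : ∀ μ, HasMaj (BlockNorm.ofBlocks g blk) (BlockNorm.ofBlocks g blk) (Sh μ) (fun y y' => cT * Real.exp (-(δ * g.dist y y'))))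
    (hCa : ∀ μ, HasMaj (BlockNorm.ofBlocks g blk) (BlockNorm.ofBlocks g blk) (Ca μ) (diagK fun _ => a₀))
    (hCb : ∀ μ, HasMaj (BlockNorm.ofBlocks g blk) (BlockNorm.ofBlocks g blk) (Cb μ) (diagK fun _ => a₀)) (μ : J) :
    HasMaj (BlockNorm.ofBlocks g (liftBlk blk J)) (BlockNorm.ofBlocks g blk) (krowOf Sd Sh Ca Cb μ)
      (fun y y' => (cT * a₀ + a₀) * (Fintype.card J * βS) * cr * Real.exp (-((δ - σ) * g.dist y y'))) := by
  have hJβ : 0 ≤ Fintype.card J * βS := mul_nonneg (Nat.cast_nonneg _) hβS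
  have hSd := hasMaj_sdiv blk hβS hS
  have hKt : HasMaj (BlockNorm.ofBlocks g blk) (BlockNorm.ofBlocks g blk) (Sh μ ∘ₗ Ca μ + Cb μ) (fun y y' => (cT * a₀ + a₀) * Real.exp (-(δ * g.dist y y'))) := by
    exact hasMaj_add_exp (hasMaj_exp_comp_diagK (b₁ := BlockNorm.ofBlocks g blk) (b₃ := BlockNorm.ofBlocks g blk) blk hcT (hSh μ) (hCa μ))
      (hasMaj_exp_of_diagK blk hd0 ha₀ δ (hCb μ))
  have h := hasMaj_comp_exp (b₁ := BlockNorm.ofBlocks g (liftBlk blk J)) (b₂ := BlockNorm.ofBlocks g blk) (b₃ := BlockNorm.ofBlocks g blk) (ρ := δ - σ)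
    htri hd hrow (by positivity) hJβ (by linarith) (by linarith) (by linarith) hKt hSd
  rw [krowOf]
  exact h.mono fun a b => le_of_eq (by rw [kappa_ofBlocks]; ring)

end OneLattice

/-! ## §2 The η-defects of `B̂` and of the rows from the letters (two lattices, paired by `π`) -/

section TwoLattices

variable {X X' J : Type} [Fintype X] [Fintype X'] [Fintype J] [DecidableEq X] [DecidableEq X'] [DecidableEq J] {g : B6.Geometry}
  (blk : X → g.Site) (π : X' → X) {σ cr : ℝ}
variable {Sd : J → ((X → ℝ) →ₗ[ℝ] (X → ℝ))} {E0 Rt : (X → ℝ) →ₗ[ℝ] (X → ℝ)} {Sh Ca Cb : J → ((X → ℝ) →ₗ[ℝ] (X → ℝ))}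
variable {Sd' : J → ((X' → ℝ) →ₗ[ℝ] (X' → ℝ))} {E0' Rt' : (X' → ℝ) →ₗ[ℝ] (X' → ℝ)} {Sh' Ca' Cb' : J → ((X' → ℝ) →ₗ[ℝ] (X' → ℝ))}
  {βS β₀ r cT a₀ mS m₀ o mT δ : ℝ}

omit [Fintype X] [Fintype X'] [Fintype J] [DecidableEq X] [DecidableEq X'] [DecidableEq J] in
/-- Leibniz for the source operator: `𝔇(B̂′, B̂) = 𝔇(Σ) + E₀′R̃′𝔇(Σ) + E₀′𝔇(R̃′,R̃)Σ + 𝔇(E₀′,E₀)R̃Σ` (`Σ = Σ_νS_νpr_ν`). [folklore] -/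
theorem idef_bopOf [Fintype J] :
    idef (pull (liftMap π J)) (pull π) (bopOf Sd' E0' Rt') (bopOf Sd E0 Rt) =
      idef (pull (liftMap π J)) (pull π) (sumJ Sd') (sumJ Sd) +
        (E0' ∘ₗ (Rt' ∘ₗ idef (pull (liftMap π J)) (pull π) (sumJ Sd') (sumJ Sd) + idef (pull π) (pull π) Rt' Rt ∘ₗ sumJ Sd) +
          idef (pull π) (pull π) E0' E0 ∘ₗ (Rt ∘ₗ sumJ Sd)) := by
  rw [bopOf, bopOf, idef_add, idef_comp (pull (liftMap π J)) (pull π) (pull π) E0' (Rt' ∘ₗ sumJ Sd') E0 (Rt ∘ₗ sumJ Sd),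
    idef_comp (pull (liftMap π J)) (pull π) (pull π) Rt' (sumJ Sd') Rt (sumJ Sd)]

omit [Fintype X] [Fintype X'] [Fintype J] [DecidableEq X] [DecidableEq X'] [DecidableEq J] in
/-- Leibniz for the rows: `𝔇(K′_μ, K_μ) = (Sh′C^a′ + C^b′)𝔇(Σ) + [Sh′𝔇(C^a′,C^a) + 𝔇(Sh′,Sh)C^a + 𝔇(C^b′,C^b)]Σ`. [folklore] -/
theorem idef_krowOf [Fintype J] (μ : J) :
    idef (pull (liftMap π J)) (pull π) (krowOf Sd' Sh' Ca' Cb' μ) (krowOf Sd Sh Ca Cb μ) =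
      (Sh' μ ∘ₗ Ca' μ + Cb' μ) ∘ₗ idef (pull (liftMap π J)) (pull π) (sumJ Sd') (sumJ Sd) +
        (Sh' μ ∘ₗ idef (pull π) (pull π) (Ca' μ) (Ca μ) ∘ₗ sumJ Sd + idef (pull π) (pull π) (Sh' μ) (Sh μ) ∘ₗ (Ca μ ∘ₗ sumJ Sd) +
          idef (pull π) (pull π) (Cb' μ) (Cb μ) ∘ₗ sumJ Sd) := by
  rw [krowOf, krowOf, idef_comp (pull (liftMap π J)) (pull π) (pull π), idef_add, idef_comp (pull π) (pull π) (pull π) (Sh' μ) (Ca' μ) (Sh μ) (Ca μ)]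
  simp only [LinearMap.add_comp, LinearMap.comp_assoc]

omit [DecidableEq X] [DecidableEq X'] [DecidableEq J] in
/-- `𝔇(Σ′, Σ) ≤ |J|·m_S·e^{−δd}` from `𝔇(S′_ν, S_ν) ≤ m_S e^{−δd}`. [folklore] -/
theorem hasMaj_idef_sdiv (hmS : 0 ≤ mS)
    (hDS : ∀ ν, HasMaj (BlockNorm.ofBlocks g blk) (BlockNorm.ofBlocks g (blk ∘ π)) (idef (pull π) (pull π) (Sd' ν) (Sd ν))
      (fun y y' => mS * Real.exp (-(δ * g.dist y y')))) :
    HasMaj (BlockNorm.ofBlocks g (liftBlk blk J)) (BlockNorm.ofBlocks g (blk ∘ π)) (idef (pull (liftMap π J)) (pull π) (sumJ Sd') (sumJ Sd))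
      (fun y y' => Fintype.card J * mS * Real.exp (-(δ * g.dist y y'))) := by
  rw [idef_sumJ]
  exact hasMaj_sumJ_exp blk hmS hDS

/-- the constant of `𝔇(B̂′, B̂)`. [folklore] -/
def mBOf (nJ βS β₀ r cr mS m₀ o : ℝ) : ℝ :=
  nJ * mS + β₀ * r * (nJ * mS) * cr + β₀ * o * (nJ * βS) * cr + m₀ * (r * (nJ * βS)) * cr

/-- the constant of `𝔇(K′_μ, K_μ)`. [folklore] -/
def mKOf (nJ βS cT a₀ mS o mT cr : ℝ) : ℝ :=
  (cT * a₀ + a₀) * (nJ * mS) * cr + (cT * o * (nJ * βS) * cr + mT + o * (nJ * βS))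

omit [DecidableEq X] [DecidableEq X'] [DecidableEq J] in
/-- **`𝔇(B̂′, B̂) ≤ m_B·e^{−(δ−σ)d}`**, `m_B = mBOf |J| β_S β₀ r c_r m_S m₀ o` — from `𝔇(S′_ν,S_ν) ≤ m_S e^{−δd}`, `𝔇(E₀′,E₀) ≤ m₀ e^{−δd}`, `𝔇(R̃′,R̃) ≤ diagK o` and the
plain letters `S_ν ≤ β_S e^{−δd}`, `E₀′ ≤ β₀ e^{−δd}`, `R̃, R̃′ ≤ diagK r`. [folklore] -/
theorem hasMaj_idef_bopOf (htri : Triangle254 g) (hd : ∀ a b : g.Site, 0 ≤ g.dist a b) (hrow : RowSum g σ cr) (hσ : 0 ≤ σ) (hσδ : σ ≤ δ)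
    (hβS : 0 ≤ βS) (hβ₀ : 0 ≤ β₀) (hr : 0 ≤ r) (hmS : 0 ≤ mS) (hm₀ : 0 ≤ m₀) (ho : 0 ≤ o)
    (hS : ∀ ν, HasMaj (BlockNorm.ofBlocks g blk) (BlockNorm.ofBlocks g blk) (Sd ν) (fun y y' => βS * Real.exp (-(δ * g.dist y y'))))
    (hE' : HasMaj (BlockNorm.ofBlocks g (blk ∘ π)) (BlockNorm.ofBlocks g (blk ∘ π)) E0' (fun y y' => β₀ * Real.exp (-(δ * g.dist y y'))))
    (hR : HasMaj (BlockNorm.ofBlocks g blk) (BlockNorm.ofBlocks g blk) Rt (diagK fun _ => r))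
    (hR' : HasMaj (BlockNorm.ofBlocks g (blk ∘ π)) (BlockNorm.ofBlocks g (blk ∘ π)) Rt' (diagK fun _ => r))
    (hDS : ∀ ν, HasMaj (BlockNorm.ofBlocks g blk) (BlockNorm.ofBlocks g (blk ∘ π)) (idef (pull π) (pull π) (Sd' ν) (Sd ν))
      (fun y y' => mS * Real.exp (-(δ * g.dist y y'))))
    (hDE : HasMaj (BlockNorm.ofBlocks g blk) (BlockNorm.ofBlocks g (blk ∘ π)) (idef (pull π) (pull π) E0' E0) (fun y y' => m₀ * Real.exp (-(δ * g.dist y y'))))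
    (hDR : HasMaj (BlockNorm.ofBlocks g blk) (BlockNorm.ofBlocks g (blk ∘ π)) (idef (pull π) (pull π) Rt' Rt) (diagK fun _ => o)) :
    HasMaj (BlockNorm.ofBlocks g (liftBlk blk J)) (BlockNorm.ofBlocks g (blk ∘ π)) (idef (pull (liftMap π J)) (pull π) (bopOf Sd' E0' Rt') (bopOf Sd E0 Rt))
      (fun y y' => mBOf (Fintype.card J) βS β₀ r cr mS m₀ o * Real.exp (-((δ - σ) * g.dist y y'))) := by
  have hJβ : 0 ≤ Fintype.card J * βS := mul_nonneg (Nat.cast_nonneg _) hβS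
  have hJm : 0 ≤ Fintype.card J * mS := mul_nonneg (Nat.cast_nonneg _) hmS
  have hSd := hasMaj_sdiv blk hβS hS
  have hDSd := hasMaj_idef_sdiv blk π hmS hDS
  -- `E₀′ ∘ (R̃′𝔇Σ + 𝔇R̃ Σ)`
  have hA1 : HasMaj (BlockNorm.ofBlocks g (liftBlk blk J)) (BlockNorm.ofBlocks g (blk ∘ π))
      (Rt' ∘ₗ idef (pull (liftMap π J)) (pull π) (sumJ Sd') (sumJ Sd) + idef (pull π) (pull π) Rt' Rt ∘ₗ sumJ Sd)
      (fun y y' => (r * (Fintype.card J * mS) + o * (Fintype.card J * βS)) * Real.exp (-(δ * g.dist y y'))) :=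
    hasMaj_add_exp (hasMaj_diagK_comp_exp (b₁ := BlockNorm.ofBlocks g (liftBlk blk J)) (b₃ := BlockNorm.ofBlocks g (blk ∘ π)) (blk ∘ π) hr hR' hDSd)
      (hasMaj_diagK_comp_exp (b₁ := BlockNorm.ofBlocks g (liftBlk blk J)) (b₃ := BlockNorm.ofBlocks g (blk ∘ π)) blk ho hDR hSd)
  have hA2 := hasMaj_comp_exp (b₁ := BlockNorm.ofBlocks g (liftBlk blk J)) (b₂ := BlockNorm.ofBlocks g (blk ∘ π)) (b₃ := BlockNorm.ofBlocks g (blk ∘ π))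
    (ρ := δ - σ) htri hd hrow hβ₀ (by positivity) (by linarith) (by linarith) (by linarith) hE' hA1
  -- `𝔇E₀ ∘ (R̃ Σ)`
  have hB1 := hasMaj_diagK_comp_exp (b₁ := BlockNorm.ofBlocks g (liftBlk blk J)) (b₃ := BlockNorm.ofBlocks g blk) blk hr hR hSd
  have hB2 := hasMaj_comp_exp (b₁ := BlockNorm.ofBlocks g (liftBlk blk J)) (b₂ := BlockNorm.ofBlocks g blk) (b₃ := BlockNorm.ofBlocks g (blk ∘ π))
    (ρ := δ - σ) htri hd hrow hm₀ (by positivity) (by linarith) (by linarith) (by linarith) hDE hB1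
  have h0 := hasMaj_exp_mono hd hJm (show δ - σ ≤ δ by linarith) hDSd
  have hsum := hasMaj_add_exp h0 (hasMaj_add_exp hA2 hB2)
  rw [idef_bopOf]
  refine hsum.mono fun a b => le_of_eq ?_
  rw [kappa_ofBlocks, kappa_ofBlocks, mBOf]
  ring

omit [DecidableEq X] [DecidableEq X'] [DecidableEq J] in
/-- **`𝔇(K′_μ, K_μ) ≤ m_K·e^{−(δ−σ)d}`**, `m_K = mKOf |J| β_S c_T a₀ m_S o m_T c_r` — from the fine plain letters `Sh′_μ ≤ c_T e^{−δd}`, `C^a′_μ, C^b′_μ ≤ diagK a₀`,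
`S_ν ≤ β_S e^{−δd}`, the defects `𝔇(S′_ν,S_ν) ≤ m_S e^{−δd}`, `𝔇(C^a′_μ,C^a_μ), 𝔇(C^b′_μ,C^b_μ) ≤ diagK o`, and THE SHIFT-DEFECT LETTER on the range of `C^a_μ∘Σ`:
`𝔇(Sh′_μ, Sh_μ)∘(C^a_μ∘Σ) ≤ m_T e^{−δd}` (on the torus: the one-step difference of a Hölder-regular function — this seat's W1 device on [B4-I] (1.111)). [folklore] -/
theorem hasMaj_idef_krowOf (htri : Triangle254 g) (hd : ∀ a b : g.Site, 0 ≤ g.dist a b) (hd0 : ∀ y : g.Site, g.dist y y = 0) (hrow : RowSum g σ cr)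
    (hσ : 0 ≤ σ) (hσδ : σ ≤ δ) (hβS : 0 ≤ βS) (hcT : 0 ≤ cT) (ha₀ : 0 ≤ a₀) (hmS : 0 ≤ mS) (ho : 0 ≤ o) (hmT : 0 ≤ mT)
    (hS : ∀ ν, HasMaj (BlockNorm.ofBlocks g blk) (BlockNorm.ofBlocks g blk) (Sd ν) (fun y y' => βS * Real.exp (-(δ * g.dist y y'))))
    (hSh' : ∀ μ, HasMaj (BlockNorm.ofBlocks g (blk ∘ π)) (BlockNorm.ofBlocks g (blk ∘ π)) (Sh' μ) (fun y y' => cT * Real.exp (-(δ * g.dist y y'))))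
    (hCa' : ∀ μ, HasMaj (BlockNorm.ofBlocks g (blk ∘ π)) (BlockNorm.ofBlocks g (blk ∘ π)) (Ca' μ) (diagK fun _ => a₀))
    (hCb' : ∀ μ, HasMaj (BlockNorm.ofBlocks g (blk ∘ π)) (BlockNorm.ofBlocks g (blk ∘ π)) (Cb' μ) (diagK fun _ => a₀))
    (hDS : ∀ ν, HasMaj (BlockNorm.ofBlocks g blk) (BlockNorm.ofBlocks g (blk ∘ π)) (idef (pull π) (pull π) (Sd' ν) (Sd ν))
      (fun y y' => mS * Real.exp (-(δ * g.dist y y'))))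
    (hDCa : ∀ μ, HasMaj (BlockNorm.ofBlocks g blk) (BlockNorm.ofBlocks g (blk ∘ π)) (idef (pull π) (pull π) (Ca' μ) (Ca μ)) (diagK fun _ => o))
    (hDCb : ∀ μ, HasMaj (BlockNorm.ofBlocks g blk) (BlockNorm.ofBlocks g (blk ∘ π)) (idef (pull π) (pull π) (Cb' μ) (Cb μ)) (diagK fun _ => o))
    (hDSh : ∀ μ, HasMaj (BlockNorm.ofBlocks g (liftBlk blk J)) (BlockNorm.ofBlocks g (blk ∘ π))
      (idef (pull π) (pull π) (Sh' μ) (Sh μ) ∘ₗ (Ca μ ∘ₗ sumJ Sd)) (fun y y' => mT * Real.exp (-(δ * g.dist y y')))) (μ : J) :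
    HasMaj (BlockNorm.ofBlocks g (liftBlk blk J)) (BlockNorm.ofBlocks g (blk ∘ π))
      (idef (pull (liftMap π J)) (pull π) (krowOf Sd' Sh' Ca' Cb' μ) (krowOf Sd Sh Ca Cb μ))
      (fun y y' => mKOf (Fintype.card J) βS cT a₀ mS o mT cr * Real.exp (-((δ - σ) * g.dist y y'))) := by
  have hJβ : 0 ≤ Fintype.card J * βS := mul_nonneg (Nat.cast_nonneg _) hβS
  have hJm : 0 ≤ Fintype.card J * mS := mul_nonneg (Nat.cast_nonneg _) hmS
  have hSd := hasMaj_sdiv blk hβS hS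
  have hDSd := hasMaj_idef_sdiv blk π hmS hDS
  -- T1 = `(Sh′C^a′ + C^b′) ∘ 𝔇Σ` at rate `δ − σ`
  have hKt' : HasMaj (BlockNorm.ofBlocks g (blk ∘ π)) (BlockNorm.ofBlocks g (blk ∘ π)) (Sh' μ ∘ₗ Ca' μ + Cb' μ)
      (fun y y' => (cT * a₀ + a₀) * Real.exp (-(δ * g.dist y y'))) :=
    hasMaj_add_exp (hasMaj_exp_comp_diagK (b₁ := BlockNorm.ofBlocks g (blk ∘ π)) (b₃ := BlockNorm.ofBlocks g (blk ∘ π)) (blk ∘ π) hcT (hSh' μ) (hCa' μ))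
      (hasMaj_exp_of_diagK (blk ∘ π) hd0 ha₀ δ (hCb' μ))
  have hT1 := hasMaj_comp_exp (b₁ := BlockNorm.ofBlocks g (liftBlk blk J)) (b₂ := BlockNorm.ofBlocks g (blk ∘ π)) (b₃ := BlockNorm.ofBlocks g (blk ∘ π))
    (ρ := δ - σ) htri hd hrow (by positivity) hJm (by linarith) (by linarith) (by linarith) hKt' hDSd
  -- T2 = `Sh′ ∘ 𝔇C^a ∘ Σ` at rate `δ − σ`
  have h2a := hasMaj_diagK_comp_exp (b₁ := BlockNorm.ofBlocks g (liftBlk blk J)) (b₃ := BlockNorm.ofBlocks g (blk ∘ π)) blk ho (hDCa μ) hSd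
  have hT2 := hasMaj_comp_exp (b₁ := BlockNorm.ofBlocks g (liftBlk blk J)) (b₂ := BlockNorm.ofBlocks g (blk ∘ π)) (b₃ := BlockNorm.ofBlocks g (blk ∘ π))
    (ρ := δ - σ) htri hd hrow hcT (by positivity) (by linarith) (by linarith) (by linarith) (hSh' μ) h2a
  -- T3 = the shift-defect letter, T4 = `𝔇C^b ∘ Σ`, both at rate `δ`, lowered
  have hT3 := hasMaj_exp_mono hd hmT (show δ - σ ≤ δ by linarith) (hDSh μ)
  have hT4 := hasMaj_exp_mono hd (by positivity) (show δ - σ ≤ δ by linarith)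
    (hasMaj_diagK_comp_exp (b₁ := BlockNorm.ofBlocks g (liftBlk blk J)) (b₃ := BlockNorm.ofBlocks g (blk ∘ π)) blk ho (hDCb μ) hSd)
  have hT2' : HasMaj (BlockNorm.ofBlocks g (liftBlk blk J)) (BlockNorm.ofBlocks g (blk ∘ π)) (Sh' μ ∘ₗ idef (pull π) (pull π) (Ca' μ) (Ca μ) ∘ₗ sumJ Sd)
      (fun a b => (BlockNorm.ofBlocks g (blk ∘ π)).κ * cT * (o * (Fintype.card J * βS)) * cr * Real.exp (-((δ - σ) * g.dist a b))) := by
    rw [← LinearMap.comp_assoc]; exact hT2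
  have hsum := hasMaj_add_exp hT1 (hasMaj_add_exp (hasMaj_add_exp hT2' hT3) hT4)
  rw [idef_krowOf]
  refine hsum.mono fun a b => le_of_eq ?_
  simp only [kappa_ofBlocks, mKOf]
  ring

end TwoLattices

/-! ## §3 The entry-2 object from its natural letters: unit, majorant, η-defect -/

section Assembly

variable {X X' J : Type} [Fintype X] [Fintype X'] [Fintype J] [DecidableEq X] [DecidableEq X'] [DecidableEq J] {g : B6.Geometry}
  (blk : X → g.Site) (π : X' → X) {σ cr : ℝ}
variable {Sd : J → ((X → ℝ) →ₗ[ℝ] (X → ℝ))} {E0 Rt : (X → ℝ) →ₗ[ℝ] (X → ℝ)} {Sh Ca Cb : J → ((X → ℝ) →ₗ[ℝ] (X → ℝ))}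
variable {Sd' : J → ((X' → ℝ) →ₗ[ℝ] (X' → ℝ))} {E0' Rt' : (X' → ℝ) →ₗ[ℝ] (X' → ℝ)} {Sh' Ca' Cb' : J → ((X' → ℝ) →ₗ[ℝ] (X' → ℝ))}
  {βS β₀ r cT a₀ mS m₀ o mT δ : ℝ}

/-- the row constant `R = (c_Ta₀ + a₀)·|J|β_S·c_r` (small with the coefficient size `a₀`). [folklore] -/
def rowConst (nJ βS cT a₀ cr : ℝ) : ℝ := (cT * a₀ + a₀) * (nJ * βS) * cr

/-- the source constant `B = |J|β_S + β₀·r·|J|β_S·c_r`. [folklore] -/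
def srcConst (nJ βS β₀ r cr : ℝ) : ℝ := nJ * βS + β₀ * r * (nJ * βS) * cr

omit [Fintype X'] [DecidableEq X'] in
/-- **THE UNIT** `1 + K̂` is invertible when `q := R·c_r² < 1`, `R = rowConst …`. [cite: Balaban1985BackgroundPropagators, (3.64) p.402 (mechanism)] -/
theorem e2Unit_of_letters (htri : Triangle254 g) (hd : ∀ a b : g.Site, 0 ≤ g.dist a b) (hd0 : ∀ y : g.Site, g.dist y y = 0) (hrow : RowSum g σ cr)
    (hσ : 0 ≤ σ) (hcr : 0 ≤ cr) (hσδ : 2 * σ ≤ δ) (hβS : 0 ≤ βS) (hcT : 0 ≤ cT) (ha₀ : 0 ≤ a₀)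
    (hS : ∀ ν, HasMaj (BlockNorm.ofBlocks g blk) (BlockNorm.ofBlocks g blk) (Sd ν) (fun y y' => βS * Real.exp (-(δ * g.dist y y'))))
    (hSh : ∀ μ, HasMaj (BlockNorm.ofBlocks g blk) (BlockNorm.ofBlocks g blk) (Sh μ) (fun y y' => cT * Real.exp (-(δ * g.dist y y'))))
    (hCa : ∀ μ, HasMaj (BlockNorm.ofBlocks g blk) (BlockNorm.ofBlocks g blk) (Ca μ) (diagK fun _ => a₀))
    (hCb : ∀ μ, HasMaj (BlockNorm.ofBlocks g blk) (BlockNorm.ofBlocks g blk) (Cb μ) (diagK fun _ => a₀))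
    (hq : 1 * rowConst (Fintype.card J) βS cT a₀ cr * cr * cr < 1) : E2Unit (krowOf Sd Sh Ca Cb) :=
  e2Unit_of_small blk htri hd hd0 hrow hσ hcr (δ := δ - σ) (show 0 ≤ rowConst (Fintype.card J) βS cT a₀ cr by unfold rowConst; positivity) (by linarith)
    (fun μ => hasMaj_krowOf blk htri hd hd0 hrow hσ (by linarith) hβS hcT ha₀ hS hSh hCa hCb μ) hq

omit [Fintype X'] [DecidableEq X'] in
/-- **THE MAJORANT OF THE DRESSED ENTRY 2 from the letters**: `E₂ = B̂∘(1+K̂)⁻¹ ≤ B·(1 − q)⁻¹·c_r·e^{−ρd}`, `B = srcConst …`, `q = R c_r²`, `ρ + 4σ ≤ δ`. [cite: Balaban1985BackgroundPropagators, Thm 3.1 (3.42) p.397 (entry «G(U)∇*»: shape) + (3.64)–(3.65) p.402 (mechanism)] -/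
theorem hasMaj_entry2_of_letters (htri : Triangle254 g) (hd : ∀ a b : g.Site, 0 ≤ g.dist a b) (hd0 : ∀ y : g.Site, g.dist y y = 0) (hrow : RowSum g σ cr)
    (hσ : 0 ≤ σ) (hcr : 0 ≤ cr) {ρ : ℝ} (hρ : 0 ≤ ρ) (hρδ : ρ + 4 * σ ≤ δ) (hβS : 0 ≤ βS) (hβ₀ : 0 ≤ β₀) (hr : 0 ≤ r) (hcT : 0 ≤ cT) (ha₀ : 0 ≤ a₀)
    (hS : ∀ ν, HasMaj (BlockNorm.ofBlocks g blk) (BlockNorm.ofBlocks g blk) (Sd ν) (fun y y' => βS * Real.exp (-(δ * g.dist y y'))))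
    (hE : HasMaj (BlockNorm.ofBlocks g blk) (BlockNorm.ofBlocks g blk) E0 (fun y y' => β₀ * Real.exp (-(δ * g.dist y y'))))
    (hR : HasMaj (BlockNorm.ofBlocks g blk) (BlockNorm.ofBlocks g blk) Rt (diagK fun _ => r))
    (hSh : ∀ μ, HasMaj (BlockNorm.ofBlocks g blk) (BlockNorm.ofBlocks g blk) (Sh μ) (fun y y' => cT * Real.exp (-(δ * g.dist y y'))))
    (hCa : ∀ μ, HasMaj (BlockNorm.ofBlocks g blk) (BlockNorm.ofBlocks g blk) (Ca μ) (diagK fun _ => a₀))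
    (hCb : ∀ μ, HasMaj (BlockNorm.ofBlocks g blk) (BlockNorm.ofBlocks g blk) (Cb μ) (diagK fun _ => a₀))
    (hq : 1 * rowConst (Fintype.card J) βS cT a₀ cr * cr * cr < 1) :
    HasMaj (BlockNorm.ofBlocks g (liftBlk blk J)) (BlockNorm.ofBlocks g blk) (e2ByParts (bopOf Sd E0 Rt) (krowOf Sd Sh Ca Cb))
      (fun y y' => srcConst (Fintype.card J) βS β₀ r cr * (1 * (1 - 1 * rowConst (Fintype.card J) βS cT a₀ cr * cr * cr)⁻¹) * cr *
        Real.exp (-(ρ * g.dist y y'))) :=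
  hasMaj_e2ByParts blk htri hd hd0 hrow hσ hcr (δ := δ - σ) (by unfold srcConst; positivity) (by unfold rowConst; positivity) hρ (by linarith)
    (hasMaj_bopOf blk htri hd hrow hσ (by linarith) hβS hβ₀ hr hS hE hR)
    (fun μ => hasMaj_krowOf blk htri hd hd0 hrow hσ (by linarith) hβS hcT ha₀ hS hSh hCa hCb μ) hq

/-- ★★ **THE η-DEFECT OF THE DRESSED ENTRY 2 FROM ITS NATURAL LETTERS — NO MIXED PIECE.**  Data: a [B6] carrier ((2.54), `d ≥ 0`, `d(y,y) = 0`, (2.61) at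
`σ ≥ 0`); coarse ∕ fine lattices `X`, `X′` paired by `π`, directions `J`; at ONE rate `δ`: the `U ≡ 1` entry-2 operators `S_ν, S′_ν ≤ β_S e^{−δd}` with defects
`𝔇(S′_ν,S_ν) ≤ m_S e^{−δd}`; the dressed entry 0, `E₀, E₀′ ≤ β₀ e^{−δd}`, `𝔇(E₀′,E₀) ≤ m₀ e^{−δd}`; the by-parts multiplier `R̃, R̃′ ≤ diagK r`, `𝔇(R̃′,R̃) ≤ diagK o`; the
one-step shifts `Sh_μ, Sh′_μ ≤ c_T e^{−δd}`; the translated coefficients `C^a_μ, C^b_μ` (both lattices) `≤ diagK a₀` with defects `≤ diagK o`; and THE SHIFT-DEFECT LETTER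
`𝔇(Sh′_μ,Sh_μ)∘(C^a_μ∘Σ) ≤ m_T e^{−δd}`.  Smallness `q = R c_r² < 1` (`R = rowConst`), `ρ + 5σ ≤ δ`.  CONCLUSION: the device's entry-2 objects
`E₂ = B̂∘(1+K̂)⁻¹` of the two lattices obey `𝔇(E₂′, E₂) ≤ (B·A·m_K·A·c_r³ + m_B·A·c_r)·e^{−ρd}`, `A = (1−q)⁻¹`, `m_B = mBOf …`, `m_K = mKOf …` — every term carries
exactly one of the rate-small letters `m_S, m₀, o, m_T`.  With `…Entry2ByParts.e0_comp_fgradAdj_eq_e2ByParts` this is the η-rate of `G(U)∇_ν*` for the first-order species.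
[cite: Balaban1985BackgroundPropagators, (3.64)–(3.65) p.402 (mechanism); Balaban1984PropagatorsII, (2.52)–(2.56) pp.232–233, Lemma 2.1 (2.61) p.234] -/
theorem hasMaj_idef_entry2_of_letters (htri : Triangle254 g) (hd : ∀ a b : g.Site, 0 ≤ g.dist a b) (hd0 : ∀ y : g.Site, g.dist y y = 0)
    (hrow : RowSum g σ cr) (hσ : 0 ≤ σ) (hcr : 0 ≤ cr) {ρ : ℝ} (hρ : 0 ≤ ρ) (hρδ : ρ + 5 * σ ≤ δ) (hβS : 0 ≤ βS) (hβ₀ : 0 ≤ β₀) (hr : 0 ≤ r)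
    (hcT : 0 ≤ cT) (ha₀ : 0 ≤ a₀) (hmS : 0 ≤ mS) (hm₀ : 0 ≤ m₀) (ho : 0 ≤ o) (hmT : 0 ≤ mT)
    (hS : ∀ ν, HasMaj (BlockNorm.ofBlocks g blk) (BlockNorm.ofBlocks g blk) (Sd ν) (fun y y' => βS * Real.exp (-(δ * g.dist y y'))))
    (hS' : ∀ ν, HasMaj (BlockNorm.ofBlocks g (blk ∘ π)) (BlockNorm.ofBlocks g (blk ∘ π)) (Sd' ν) (fun y y' => βS * Real.exp (-(δ * g.dist y y'))))
    (hE' : HasMaj (BlockNorm.ofBlocks g (blk ∘ π)) (BlockNorm.ofBlocks g (blk ∘ π)) E0' (fun y y' => β₀ * Real.exp (-(δ * g.dist y y'))))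
    (hR : HasMaj (BlockNorm.ofBlocks g blk) (BlockNorm.ofBlocks g blk) Rt (diagK fun _ => r))
    (hR' : HasMaj (BlockNorm.ofBlocks g (blk ∘ π)) (BlockNorm.ofBlocks g (blk ∘ π)) Rt' (diagK fun _ => r))
    (hSh : ∀ μ, HasMaj (BlockNorm.ofBlocks g blk) (BlockNorm.ofBlocks g blk) (Sh μ) (fun y y' => cT * Real.exp (-(δ * g.dist y y'))))
    (hSh' : ∀ μ, HasMaj (BlockNorm.ofBlocks g (blk ∘ π)) (BlockNorm.ofBlocks g (blk ∘ π)) (Sh' μ) (fun y y' => cT * Real.exp (-(δ * g.dist y y'))))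
    (hCa : ∀ μ, HasMaj (BlockNorm.ofBlocks g blk) (BlockNorm.ofBlocks g blk) (Ca μ) (diagK fun _ => a₀))
    (hCa' : ∀ μ, HasMaj (BlockNorm.ofBlocks g (blk ∘ π)) (BlockNorm.ofBlocks g (blk ∘ π)) (Ca' μ) (diagK fun _ => a₀))
    (hCb : ∀ μ, HasMaj (BlockNorm.ofBlocks g blk) (BlockNorm.ofBlocks g blk) (Cb μ) (diagK fun _ => a₀))
    (hCb' : ∀ μ, HasMaj (BlockNorm.ofBlocks g (blk ∘ π)) (BlockNorm.ofBlocks g (blk ∘ π)) (Cb' μ) (diagK fun _ => a₀))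
    (hDS : ∀ ν, HasMaj (BlockNorm.ofBlocks g blk) (BlockNorm.ofBlocks g (blk ∘ π)) (idef (pull π) (pull π) (Sd' ν) (Sd ν))
      (fun y y' => mS * Real.exp (-(δ * g.dist y y'))))
    (hDE : HasMaj (BlockNorm.ofBlocks g blk) (BlockNorm.ofBlocks g (blk ∘ π)) (idef (pull π) (pull π) E0' E0) (fun y y' => m₀ * Real.exp (-(δ * g.dist y y'))))
    (hDR : HasMaj (BlockNorm.ofBlocks g blk) (BlockNorm.ofBlocks g (blk ∘ π)) (idef (pull π) (pull π) Rt' Rt) (diagK fun _ => o))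
    (hDCa : ∀ μ, HasMaj (BlockNorm.ofBlocks g blk) (BlockNorm.ofBlocks g (blk ∘ π)) (idef (pull π) (pull π) (Ca' μ) (Ca μ)) (diagK fun _ => o))
    (hDCb : ∀ μ, HasMaj (BlockNorm.ofBlocks g blk) (BlockNorm.ofBlocks g (blk ∘ π)) (idef (pull π) (pull π) (Cb' μ) (Cb μ)) (diagK fun _ => o))
    (hDSh : ∀ μ, HasMaj (BlockNorm.ofBlocks g (liftBlk blk J)) (BlockNorm.ofBlocks g (blk ∘ π))
      (idef (pull π) (pull π) (Sh' μ) (Sh μ) ∘ₗ (Ca μ ∘ₗ sumJ Sd)) (fun y y' => mT * Real.exp (-(δ * g.dist y y'))))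
    (hq : 1 * rowConst (Fintype.card J) βS cT a₀ cr * cr * cr < 1) :
    HasMaj (BlockNorm.ofBlocks g (liftBlk blk J)) (BlockNorm.ofBlocks g (blk ∘ π))
      (idef (pull (liftMap π J)) (pull π) (e2ByParts (bopOf Sd' E0' Rt') (krowOf Sd' Sh' Ca' Cb')) (e2ByParts (bopOf Sd E0 Rt) (krowOf Sd Sh Ca Cb)))
      (fun y y' => (srcConst (Fintype.card J) βS β₀ r cr * (1 * (1 - 1 * rowConst (Fintype.card J) βS cT a₀ cr * cr * cr)⁻¹) *
          mKOf (Fintype.card J) βS cT a₀ mS o mT cr * cr * (1 * (1 - 1 * rowConst (Fintype.card J) βS cT a₀ cr * cr * cr)⁻¹) * cr * cr +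
        mBOf (Fintype.card J) βS β₀ r cr mS m₀ o * (1 * (1 - 1 * rowConst (Fintype.card J) βS cT a₀ cr * cr * cr)⁻¹) * cr) *
        Real.exp (-(ρ * g.dist y y'))) :=
  hasMaj_idef_e2ByParts blk π htri hd hd0 hrow hσ hcr (δ := δ - σ) (by unfold srcConst; positivity) (by unfold rowConst; positivity)
    (by unfold mBOf; positivity) (by unfold mKOf; positivity) hρ (by linarith)
    (hasMaj_bopOf (blk ∘ π) htri hd hrow hσ (by linarith) hβS hβ₀ hr hS' hE' hR')
    (hasMaj_idef_bopOf blk π htri hd hrow hσ (by linarith) hβS hβ₀ hr hmS hm₀ ho hS hE' hR hR' hDS hDE hDR)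
    (fun μ => hasMaj_krowOf blk htri hd hd0 hrow hσ (by linarith) hβS hcT ha₀ hS hSh hCa hCb μ)
    (fun μ => hasMaj_krowOf (blk ∘ π) htri hd hd0 hrow hσ (by linarith) hβS hcT ha₀ hS' hSh' hCa' hCb' μ)
    (fun μ => hasMaj_idef_krowOf blk π htri hd hd0 hrow hσ (by linarith) hβS hcT ha₀ hmS ho hmT hS hSh' hCa' hCb' hDS hDCa hDCb hDSh μ) hq

end Assembly

end Summit.QuantumFields.YangMills.BalabanUVNodes.N15.BackgroundLayer

end
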